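import Mathlib
import HarnessLib
import Literature.NumberTheory.DiophantineGeometry.RothPrelim
import Literature.NumberTheory.Transcendental.IntegerTaylor

/-!
# Roth's theorem after Schmidt (LNM 785, Ch. V) — Taylor's formula and Lemma 6A

Source: W. M. Schmidt, *Diophantine Approximation*, LNM 785 (1980), Ch. V §§5–6 [Schmidt1980].

The operators `P ↦ P_i` (`Roth.hasseD`, RothPrelim's explicit binomial form (5.1)) are the
multivariate Hasse derivatives; the tree already has them, over commutative rings, as the Taylor
coefficients `Literature.NumberTheory.Transcendental.Taylor.taylorCoeff i P = coeff_i P(X + Y)`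
(`IntegerTaylor.lean`, the tool of Diaz 1989). This file proves the **bridge**
`Roth.hasseD_eq_taylorCoeff : hasseD i P = Taylor.taylorCoeff i P` (by the product rule
`(P·X_h)_i = P_i·X_h + P_{i-e_h}`, i.e. Pascal's rule coefficientwise) and transports along it:

* the **Leibniz rule** `(PQ)_j = Σ_{i+i'=j} P_i Q_{i'}` (Schmidt's (6.1) with `C(i,i') = 1`, as
  he remarks) from `Taylor.taylorCoeff_mul`, and **Taylor's formula**
  `P(x) = Σ_i P_i(a) Π_h (x_h - a_h)^{i_h}` (used in §8 and §10) from
  `Taylor.eval₂_eq_sum_taylorCoeff`;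
* the composition rule `(P_i)_j = C(i+j, i) P_{i+j}` (directly from (5.1));
* **Lemma 6A (i)** `Ind P_i ≥ Ind P - Σ i_h/r_h` and **Lemma 6A (iii, ≥)**
  `Ind (PQ) ≥ Ind P + Ind Q`, in the predicate form `Roth.IndexGe` of `RothPrelim.lean`
  (part (ii) is `IndexGe.add` there; the reverse inequality of (iii) is only needed, and proved,
  for polynomials in separated variables in the file on Roth's Lemma).

## References

* [Schmidt1980] W. M. Schmidt, *Diophantine Approximation*, LNM 785, Springer 1980, Ch. V §5
  (Lemma 5A, Taylor's formula as used on pp. 126, 133), §6 (Lemma 6A).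
-/

noncomputable section

open MvPolynomial

namespace Literature.NumberTheory.DiophantineGeometry

namespace Roth

variable {σ : Type*} {R : Type*} [CommSemiring R]

/-! ### `(C c)_i` and the degree box -/

/-- `(C c)_i` is `C c` for `i = 0` and `0` otherwise. [folklore] -/
theorem hasseD_C [DecidableEq σ] (i : σ →₀ ℕ) (c : R) :
    hasseD i (C c : MvPolynomial σ R) = if i = 0 then C c else 0 := by
  split_ifs with hi
  · subst hi; simp
  · rw [← monomial_zero', hasseD_monomial]
    have : ¬ i ≤ 0 := fun h => hi (by ext l; exact Nat.le_zero.mp (h l))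
    rw [prod_choose_eq_zero_of_not_le this]
    simp

/-- If `P_i ≠ 0` then `i_h ≤ deg_{X_h} P` for every `h`. [folklore] -/
theorem le_degreeOf_of_hasseD_ne_zero {i : σ →₀ ℕ} {P : MvPolynomial σ R} (h : hasseD i P ≠ 0)
    (l : σ) : i l ≤ degreeOf l P := by
  by_contra hlt
  exact h (hasseD_eq_zero_of_degreeOf_lt (not_le.mp hlt))

section Fintype

variable [Fintype σ]

/-! ### Coefficient formula with a product over all variables -/

/-- Coefficient formula for `P_i` with the binomial factor written as a product over all
variables: `coeff_k P_i = (Π_h C(k_h+i_h, i_h)) · coeff_{k+i} P`. [cite: Schmidt1980, Ch. V §5 (5.1)] -/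
theorem coeff_hasseD' (i k : σ →₀ ℕ) (P : MvPolynomial σ R) :
    coeff k (hasseD i P) = ((∏ h, ((k + i) h).choose (i h) : ℕ) : R) * coeff (k + i) P := by
  rw [coeff_hasseD, Finsupp.prod_fintype]
  intro h
  simp

/-! ### Composition of the operators -/

/-- **Composition rule**: `(P_i)_j = C(i₁+j₁, i₁)⋯C(i_m+j_m, i_m) · P_{i+j}`.
[cite: Schmidt1980, Ch. V proof of Lemma 6A (i)] -/
theorem hasseD_hasseD (i j : σ →₀ ℕ) (P : MvPolynomial σ R) :
    hasseD j (hasseD i P) = (∏ h, ((i + j) h).choose (i h)) • hasseD (i + j) P := by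
  ext k
  rw [coeff_hasseD', coeff_hasseD', coeff_smul, coeff_hasseD', nsmul_eq_mul, ← mul_assoc,
    ← mul_assoc, ← Nat.cast_mul, ← Nat.cast_mul, add_assoc k j i, add_comm j i]
  congr 2
  rw [← Finset.prod_mul_distrib, ← Finset.prod_mul_distrib]
  refine Finset.prod_congr rfl fun h _ => ?_
  simp only [Finsupp.coe_add, Pi.add_apply]
  -- `C(k+j, j) C(k+i+j, i) = C(i+j, i) C(k+i+j, i+j)` at each coordinate
  have h1 := Nat.choose_mul (n := k h + (i h + j h)) (k := i h + j h) (s := i h) (by omega)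
  have h2 : k h + (i h + j h) - i h = k h + j h := by omega
  have h3 : i h + j h - i h = j h := by omega
  rw [h2, h3] at h1
  rw [mul_comm ((k h + j h).choose (j h))]
  linarith [h1]

variable [DecidableEq σ]

/-! ### The product rule with a variable -/

/-- **Product rule with a variable**: `(P · X_h)_i = P_i · X_h + P_{i - e_h}`, the second term
being absent when `i_h = 0` (Pascal's rule `C(n+1,k) = C(n,k) + C(n,k-1)` coefficientwise).
[folklore] -/
theorem hasseD_mul_X (i : σ →₀ ℕ) (P : MvPolynomial σ R) (h : σ) :
    hasseD i (P * X h) =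
      hasseD i P * X h + (if i h = 0 then 0 else hasseD (i - Finsupp.single h 1) P) := by
  ext k
  rw [coeff_add, coeff_hasseD', coeff_mul_X', coeff_mul_X']
  by_cases hi : i h = 0
  · rw [if_pos hi, coeff_zero, add_zero]
    by_cases hk : h ∈ k.support
    · have hk1 : 1 ≤ k h := Nat.one_le_iff_ne_zero.mpr (Finsupp.mem_support_iff.mp hk)
      have hki : h ∈ (k + i).support := by
        rw [Finsupp.mem_support_iff, Finsupp.add_apply]; omega
      rw [if_pos hk, if_pos hki, coeff_hasseD']
      have e1 : k + i - Finsupp.single h 1 = k - Finsupp.single h 1 + i := by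
        ext l
        rcases eq_or_ne h l with rfl | hl
        · simp; omega
        · simp [Finsupp.single_eq_of_ne' hl]
      rw [e1]
      congr 2
      refine Finset.prod_congr rfl fun l _ => ?_
      by_cases hl : h = l
      · subst hl; simp [hi]
      · simp [Finsupp.single_eq_of_ne' hl]
    · have hki : h ∉ (k + i).support := by
        rw [Finsupp.mem_support_iff, Finsupp.add_apply, hi, add_zero]
        exact fun hne => hk (Finsupp.mem_support_iff.mpr hne)
      rw [if_neg hk, if_neg hki, mul_zero]
  · have hi1 : 1 ≤ i h := Nat.one_le_iff_ne_zero.mpr hi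
    rw [if_neg hi, coeff_hasseD' (i - Finsupp.single h 1) k P]
    have hki : h ∈ (k + i).support := by
      rw [Finsupp.mem_support_iff, Finsupp.add_apply]; omega
    rw [if_pos hki]
    have hsingle : ∀ l, l ≠ h → (Finsupp.single h 1 : σ →₀ ℕ) l = 0 := fun l hl =>
      Finsupp.single_eq_of_ne hl
    set n := k + i - Finsupp.single h 1 with hn
    have hnl : ∀ l, l ≠ h → n l = (k + i) l := by
      intro l hl
      simp [hn, hsingle l hl]
    have hnh : n h + 1 = k h + i h := by
      simp only [hn, Finsupp.coe_tsub, Finsupp.coe_add, Pi.sub_apply, Pi.add_apply,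
        Finsupp.single_eq_same]
      omega
    have hih : ∀ l, l ≠ h → (i - Finsupp.single h 1 : σ →₀ ℕ) l = i l := by
      intro l hl
      rw [Finsupp.tsub_apply, hsingle l hl, Nat.sub_zero]
    have hihh : (i - Finsupp.single h 1 : σ →₀ ℕ) h = i h - 1 := by simp
    have e2 : k + (i - Finsupp.single h 1) = n := by
      ext l
      rcases eq_or_ne l h with rfl | hl
      · rw [Finsupp.add_apply, hihh]; omega
      · rw [Finsupp.add_apply, hih l hl, hnl l hl, Finsupp.add_apply]
    rw [e2]
    by_cases hk : h ∈ k.support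
    · have hk1 : 1 ≤ k h := Nat.one_le_iff_ne_zero.mpr (Finsupp.mem_support_iff.mp hk)
      rw [if_pos hk, coeff_hasseD']
      have e1 : k - Finsupp.single h 1 + i = n := by
        ext l
        rcases eq_or_ne l h with rfl | hl
        · simp; omega
        · rw [Finsupp.add_apply, Finsupp.tsub_apply, hsingle l hl, hnl l hl, Finsupp.add_apply]
          omega
      rw [e1, ← add_mul, ← Nat.cast_add]
      congr 2
      -- Pascal's rule at the coordinate `h`; the other factors agree.
      rw [← Finset.mul_prod_erase Finset.univ _ (Finset.mem_univ h),
        ← Finset.mul_prod_erase Finset.univ _ (Finset.mem_univ h),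
        ← Finset.mul_prod_erase Finset.univ _ (Finset.mem_univ h)]
      have e3 : ∏ l ∈ Finset.univ.erase h, (n l).choose ((i - Finsupp.single h 1 : σ →₀ ℕ) l) =
          ∏ l ∈ Finset.univ.erase h, (n l).choose (i l) :=
        Finset.prod_congr rfl fun l hl => by rw [hih l (Finset.ne_of_mem_erase hl)]
      have e4 : ∏ l ∈ Finset.univ.erase h, ((k + i) l).choose (i l) =
          ∏ l ∈ Finset.univ.erase h, (n l).choose (i l) :=
        Finset.prod_congr rfl fun l hl => by rw [hnl l (Finset.ne_of_mem_erase hl)]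
      rw [e3, e4, ← add_mul, hihh]
      congr 1
      rw [Finsupp.add_apply, ← hnh, Nat.choose_succ_left _ _ (by omega), add_comm]
    · have hk0 : k h = 0 := by simpa [Finsupp.mem_support_iff] using hk
      rw [if_neg hk, zero_add]
      congr 2
      refine Finset.prod_congr rfl fun l _ => ?_
      by_cases hl : l = h
      · subst hl
        rw [hihh]
        have : n l = i l - 1 := by omega
        rw [this, Finsupp.add_apply, hk0, zero_add, Nat.choose_self, Nat.choose_self]
      · rw [hnl l hl, hih l hl]

/-! ### The universal Taylor expansion `P(X + Y)` -/

end Fintype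

/-! ### The bridge to the tree's Taylor coefficients -/

section Bridge

open Literature.NumberTheory.Transcendental

variable {S : Type*} [CommRing S] [Fintype σ] [DecidableEq σ]

/-- **Bridge**: Schmidt's `P_i` (the binomial formula (5.1)) is the coefficient of `Y^i` in
`P(X + Y)`, i.e. the tree's `Taylor.taylorCoeff i P` (`IntegerTaylor.lean`); equivalently
`P(X + Y) = Σ_i P_i(X) Y^i`. [cite: Schmidt1980, Ch. V §8 (Taylor's formula)] -/
theorem hasseD_eq_taylorCoeff (i : σ →₀ ℕ) (P : MvPolynomial σ S) :
    hasseD i P = Taylor.taylorCoeff i P := by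
  unfold Taylor.taylorCoeff
  induction P using MvPolynomial.induction_on generalizing i with
  | C c =>
    rw [Taylor.shift_C, hasseD_C, coeff_C]
    by_cases hi : i = 0
    · rw [if_pos hi.symm, if_pos hi]
    · rw [if_neg (Ne.symm hi), if_neg hi]
  | add p q hp hq => rw [map_add, coeff_add, ← hp, ← hq, hasseD_add]
  | mul_X p h hp =>
    rw [map_mul, Taylor.shift_X, mul_add, coeff_add, hasseD_mul_X, mul_comm (Taylor.shift p) (C (X h)),
      coeff_C_mul, coeff_mul_X', ← hp, mul_comm]
    congr 1
    by_cases hi : i h = 0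
    · rw [if_pos hi, if_neg (by simpa using hi)]
    · rw [if_neg hi, if_pos (by simpa using hi), hp]

/-- Membership in the support of `P(X + Y)`: `Y^i` occurs iff `P_i ≠ 0`. [folklore] -/
theorem mem_support_shift (P : MvPolynomial σ S) (i : σ →₀ ℕ) :
    i ∈ (Taylor.shift P).support ↔ hasseD i P ≠ 0 := by
  rw [mem_support_iff, hasseD_eq_taylorCoeff]
  rfl

/-! ### The Leibniz rule -/

/-- **Leibniz rule** (Schmidt's (6.1) with `C(i, i') = 1`): `(PQ)_j = Σ_{i + i' = j} P_i Q_{i'}`;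
transported from `Taylor.taylorCoeff_mul`. [cite: Schmidt1980, Ch. V §6 (6.1)] -/
theorem hasseD_mul (P Q : MvPolynomial σ S) (j : σ →₀ ℕ) :
    hasseD j (P * Q) =
      ∑ x ∈ Finset.HasAntidiagonal.antidiagonal j, hasseD x.1 P * hasseD x.2 Q := by
  simp only [hasseD_eq_taylorCoeff]
  exact Taylor.taylorCoeff_mul j P Q

/-! ### Taylor's formula -/

/-- **Taylor's formula** (Schmidt, pp. 126 and 133): for points `a, x` of a commutative
`S`-algebra, `P(x) = Σ_i P_i(a) · Π_h (x_h - a_h)^{i_h}`, the sum running over the multi-indices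
`i` with `P_i ≠ 0` (the support of `P(X + Y)`); transported from
`Taylor.eval₂_eq_sum_taylorCoeff`. [cite: Schmidt1980, Ch. V §8 (Taylor's formula)] -/
theorem taylor_formula {B : Type*} [CommRing B] [Algebra S B] (a x : σ → B)
    (P : MvPolynomial σ S) :
    aeval x P = ∑ i ∈ (Taylor.shift P).support,
      aeval a (hasseD i P) * ∏ h, (x h - a h) ^ (i h) := by
  rw [MvPolynomial.aeval_def, Taylor.eval₂_eq_sum_taylorCoeff (algebraMap S B) a x P]
  refine Finset.sum_congr rfl fun i _ => ?_
  rw [hasseD_eq_taylorCoeff, MvPolynomial.aeval_def]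
  congr 1
  apply Finset.prod_subset (Finset.subset_univ _)
  intro h _ hh
  rw [Finsupp.notMem_support_iff.mp hh, pow_zero]

/-- Taylor's formula with the sum taken over any finite set of multi-indices containing those
with `P_i ≠ 0`. [cite: Schmidt1980, Ch. V §8 (Taylor's formula)] -/
theorem taylor_formula_of_subset {B : Type*} [CommRing B] [Algebra S B] (a x : σ → B)
    (P : MvPolynomial σ S) {T : Finset (σ →₀ ℕ)} (hT : ∀ i, hasseD i P ≠ 0 → i ∈ T) :
    aeval x P = ∑ i ∈ T, aeval a (hasseD i P) * ∏ h, (x h - a h) ^ (i h) := by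
  rw [taylor_formula a x P]
  apply Finset.sum_subset
  · intro i hi
    exact hT i ((mem_support_shift P i).mp hi)
  · intro i _ hi
    rw [mem_support_shift, not_not] at hi
    rw [hi, map_zero, zero_mul]

/-- A non-zero polynomial has, at every point of an algebra into which the coefficients embed,
some non-vanishing `P_i(a)` (from `Taylor.eq_zero_of_forall_eval₂_taylorCoeff`). [folklore] -/
theorem exists_aeval_hasseD_ne_zero {B : Type*} [CommRing B] [Algebra S B]
    (hinj : Function.Injective (algebraMap S B)) (a : σ → B) {P : MvPolynomial σ S}
    (hP : P ≠ 0) : ∃ i, aeval a (hasseD i P) ≠ 0 := by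
  by_contra h
  push Not at h
  apply hP
  apply Taylor.eq_zero_of_forall_eval₂_taylorCoeff hinj a
  intro i
  rw [← hasseD_eq_taylorCoeff, ← MvPolynomial.aeval_def]
  exact h i

end Bridge

section Fintype2

variable [Fintype σ]

/-- The multi-indices `i` with `P_i ≠ 0` lie in the box `Π_h [0, r_h]` as soon as
`deg_{X_h} P ≤ r_h`; as a `Finset`, the box is `Finset.Iic` of the corresponding finitely
supported function. [folklore] -/
theorem mem_Iic_of_hasseD_ne_zero [DecidableEq σ] {i : σ →₀ ℕ} {P : MvPolynomial σ R} (r : σ → ℕ)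
    (hdeg : ∀ h, degreeOf h P ≤ r h) (h : hasseD i P ≠ 0) :
    i ∈ Finset.Iic (Finsupp.equivFunOnFinite.symm r) := by
  rw [Finset.mem_Iic]
  intro l
  simpa using (le_degreeOf_of_hasseD_ne_zero h l).trans (hdeg l)

/-! ### Lemma 6A (i) and (iii) -/

section Index

variable {S : Type*} [CommRing S] {A : Type*} [CommRing A] [Algebra S A]

/-- Pointwise composition rule: `(P_i)_j (a) = C · P_{i+j}(a)` with `C = Π C(i_h+j_h, i_h) ≠ 0`.
[cite: Schmidt1980, Ch. V proof of Lemma 6A (i)] -/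
theorem aeval_hasseD_hasseD (a : σ → A) (i j : σ →₀ ℕ) (P : MvPolynomial σ S) :
    aeval a (hasseD j (hasseD i P)) =
      ((∏ h, ((i + j) h).choose (i h) : ℕ) : A) * aeval a (hasseD (i + j) P) := by
  rw [hasseD_hasseD, map_nsmul, nsmul_eq_mul]

/-- **Lemma 6A (i)** (Schmidt, Ch. V): `Ind P_i ≥ Ind P - Σ_h i_h/r_h`.
[cite: Schmidt1980, Ch. V Lemma 6A (i)] -/
theorem IndexGe.hasseD {P : MvPolynomial σ S} {a : σ → A} {r : σ → ℕ} {t : ℝ}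
    (hP : IndexGe P a r t) (i : σ →₀ ℕ) : IndexGe (hasseD i P) a r (t - wt r i) := by
  intro j hj
  rw [aeval_hasseD_hasseD, hP (i + j) (by rw [wt_add]; linarith), mul_zero]

/-- **Leibniz rule, evaluated**: `(PQ)_j(a) = Σ_{i+i'=j} P_i(a) Q_{i'}(a)`.
[cite: Schmidt1980, Ch. V §6 (6.1)] -/
theorem aeval_hasseD_mul [DecidableEq σ] (a : σ → A) (P Q : MvPolynomial σ S) (j : σ →₀ ℕ) :
    aeval a (hasseD j (P * Q)) =
      ∑ x ∈ Finset.HasAntidiagonal.antidiagonal j, aeval a (hasseD x.1 P) * aeval a (hasseD x.2 Q) := by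
  rw [hasseD_mul, map_sum]
  simp only [map_mul]

/-- **Lemma 6A (iii), lower bound** (Schmidt, Ch. V): `Ind (PQ) ≥ Ind P + Ind Q`.
[cite: Schmidt1980, Ch. V Lemma 6A (iii), (6.2)] -/
theorem IndexGe.mul {P Q : MvPolynomial σ S} {a : σ → A} {r : σ → ℕ} {s t : ℝ}
    (hP : IndexGe P a r s) (hQ : IndexGe Q a r t) : IndexGe (P * Q) a r (s + t) := by
  classical
  intro j hj
  rw [aeval_hasseD_mul]
  refine Finset.sum_eq_zero fun x hx => ?_
  rw [Finset.HasAntidiagonal.mem_antidiagonal] at hx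
  have hwt : wt r x.1 + wt r x.2 = wt r j := by rw [← wt_add, hx]
  by_cases h1 : wt r x.1 < s
  · rw [hP x.1 h1, zero_mul]
  · have h2 : wt r x.2 < t := by push Not at h1; linarith
    rw [hQ x.2 h2, mul_zero]

/-- A finite product of polynomials of indices `≥ t_k` has index `≥ Σ t_k`.
[cite: Schmidt1980, Ch. V Lemma 6A (iii)] -/
theorem IndexGe.prod {ι : Type*} (s : Finset ι) {f : ι → MvPolynomial σ S} {a : σ → A}
    {r : σ → ℕ} {t : ι → ℝ} (h : ∀ k ∈ s, IndexGe (f k) a r (t k)) :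
    IndexGe (∏ k ∈ s, f k) a r (∑ k ∈ s, t k) := by
  classical
  induction s using Finset.induction_on with
  | empty =>
    intro j hj
    simp only [Finset.sum_empty] at hj
    exact absurd hj (not_lt.mpr (wt_nonneg r j))
  | insert k s hk ih =>
    rw [Finset.prod_insert hk, Finset.sum_insert hk]
    exact (h k (Finset.mem_insert_self k s)).mul (ih fun l hl => h l (Finset.mem_insert_of_mem hl))

end Index

end Fintype2

end Roth

end Literature.NumberTheory.DiophantineGeometry
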